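import Summits.BirchSwinnertonDyer.BirchSwinnertonDyer.Theorems.ResidualThetaTransportAtTwoThetaLayerLambdaCongruenceAtTwoPeriodFactor
import HarnessLib

/-!
# Crux `ThetaLayerLambdaCongruenceAtTwo` (stmt-BirchSwinnertonDyer-20688, route ResidualThetaTransportAtTwo), line
# `birth`, stub (C3k) — ITEM B1 packaged: the LINEAR FORM ON THE PERIOD LATTICE induced by a `T₂`-killed symbol
# function, and (B2) the Hecke operators on period functionals with EXPLICIT translates (lead prover bsd-wall-rtt-p3 g3;
# `--supports stmt-BirchSwinnertonDyer-20688 --as helper`; closes nothing)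

HONEST FRAMING. THEOREMS only; external input = the genus named fact `twelve_mul_finrank_cuspForm_two (Gamma0 N)` as
a hypothesis. Nothing about any curve is asserted; BSD is not proved by any of this.

WHAT.
* §1 `exists_linearMap_span_periodFunctional`: under the hypotheses of `…PeriodFactor` (`N` odd, `R` without
  `3`-torsion, `Φ` a Γ₀(N)-symbol function with `T₂Φ = 0`, genus fact) there is a `ℤ`-linear map
  `F : ℤ·{periodFunctional N γ} = H₁(X₀(N), ℤ) → R` with `F({∞, γ∞}) = Φ(γ·∞)` for every `γ ∈ Γ₀(N)` — the first
  isomorphism theorem applied to `…PeriodFactor.periods_eq_zero_of_periodFunctionals_eq_zero`.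
* §2 `exists_heckeT_translates`: for a prime `p` and `γ ∈ Γ₀(N)` there are `δ₀, …, δ_{p−1}, δ' ∈ Γ₀(N)` (the tree's
  `exists_gamma0_inftyImage_tpB/tpD`: `δⱼ·∞ = (γ∞ + j)/p`, `δ'·∞ = p·γ∞`) such that SIMULTANEOUSLY
  `{∞, γ∞}_{T_p h} = Σⱼ {∞, δⱼ∞}_h + 𝟙_{p∤N} {∞, δ'∞}_h` for every cusp form `h` (the tree's `exists_cuspSymbol_heckeT`)
  AND `(T_pΦ)(γ·∞) = Σⱼ Φ(δⱼ·∞) + 𝟙_{p∤N} Φ(δ'·∞)` for EVERY function `Φ : ℚ → R` (`T_pΦ(x) = Σⱼ Φ((x+j)/p) +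
  𝟙_{p∤N}Φ(px)`, the shape of (C3k)'s `T_q`/`U_ℓ` hypotheses). Consequently (`apply_heckeT_smul_eq`) the linear form
  `F` of §1 of a `T_p`-EIGEN symbol function (`T_pΦ = aΦ`) satisfies `F(T_p·λ) = a·F(λ)` on generators — `F` is an
  eigenvector of the dual Hecke action on `H₁(X₀(N), ℤ)` (B2 of `Lines/birth-C3k-plan.md`).
NOT here: B3 (the quotient `Λ/𝔪Λ`), B4/B5.

References: [Manin1972] Thm. 1.9; [CremonaAlgorithms1997] §2.4 (2.4.1)–(2.4.2); [Merel1994] §1.2.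
-/

noncomputable section

-- justification: the `Summit.BirchSwinnertonDyer.BirchSwinnertonDyer.…` path repeats a component (route-file convention)
set_option linter.dupNamespace false

open scoped Classical MatrixGroups

open CongruenceSubgroup Matrix.SpecialLinearGroup ModularGroup
open Literature.NumberTheory.EllipticCurves.ModularForms

namespace Summit.BirchSwinnertonDyer.BirchSwinnertonDyer.Theorems.ThetaLayerLambdaCongruenceAtTwo

/-! ## §1. The linear form on the period lattice -/

section Lift

variable {R : Type} [AddCommGroup R] {N : ℕ} [NeZero N] {Φ : ℚ → R}

/-- **The period homomorphism of a `T₂`-killed symbol function is a linear form on `H₁(X₀(N), ℤ)`**: there is a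
`ℤ`-linear `F` on the `ℤ`-span of the period functionals `{∞, γ∞}` in `S₂(Γ₀(N))^∨` with `F({∞, γ∞}) = Φ(γ·∞)`
(`0` if `γ·∞ = ∞`). First isomorphism theorem + `periods_eq_zero_of_periodFunctionals_eq_zero`.
[cite: Manin1972, Thm. 1.9] -/
theorem exists_linearMap_span_periodFunctional (hN : Odd N)
    (hM : ∀ (γ : Gamma0 N) (r : ℚ), ((γ : SL(2, ℤ)) 1 0 : ℚ) * r + ((γ : SL(2, ℤ)) 1 1 : ℚ) ≠ 0 →
      Φ ((((γ : SL(2, ℤ)) 0 0 : ℚ) * r + ((γ : SL(2, ℤ)) 0 1 : ℚ)) /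
        (((γ : SL(2, ℤ)) 1 0 : ℚ) * r + ((γ : SL(2, ℤ)) 1 1 : ℚ))) =
        (if ((γ : SL(2, ℤ)) 1 0) = 0 then 0 else Φ ((((γ : SL(2, ℤ)) 0 0 : ℚ)) / (((γ : SL(2, ℤ)) 1 0 : ℚ)))) + Φ r)
    (hT : ∀ x : ℚ, (∑ j : Fin 2, Φ ((x + j) / 2)) + Φ (2 * x) = 0)
    (h3 : ∀ r : R, r + r + r = 0 → r = 0)
    (hgenus : twelve_mul_finrank_cuspForm_two (Gamma0 N)) :
    ∃ F : Submodule.span ℤ (Set.range (periodFunctional N)) →ₗ[ℤ] R,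
      ∀ γ : Gamma0 N, F ⟨periodFunctional N γ, Submodule.subset_span ⟨γ, rfl⟩⟩ =
        (if ((γ : SL(2, ℤ)) 1 0) = 0 then 0 else Φ ((((γ : SL(2, ℤ)) 0 0 : ℚ)) / (((γ : SL(2, ℤ)) 1 0 : ℚ)))) := by
  let L₁ : (Gamma0 N →₀ ℤ) →ₗ[ℤ] Module.Dual ℂ (CuspForm (Gamma0 N) 2) :=
    Finsupp.linearCombination ℤ (periodFunctional N)
  let L₂ : (Gamma0 N →₀ ℤ) →ₗ[ℤ] R :=
    Finsupp.linearCombination ℤ (fun γ : Gamma0 N ↦ (if ((γ : SL(2, ℤ)) 1 0) = 0 then 0 else Φ ((((γ : SL(2, ℤ)) 0 0 : ℚ)) / (((γ : SL(2, ℤ)) 1 0 : ℚ)))))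
  have hker : LinearMap.ker L₁ ≤ LinearMap.ker L₂ := by
    intro l hl
    rw [LinearMap.mem_ker, Finsupp.linearCombination_apply, Finsupp.sum, ← Finset.sum_coe_sort] at hl ⊢
    exact periods_eq_zero_of_periodFunctionals_eq_zero hN hM hT h3 hgenus (fun i : l.support ↦ l i)
      (fun i ↦ (i : Gamma0 N)) hl
  have hrange : LinearMap.range L₁ = Submodule.span ℤ (Set.range (periodFunctional N)) := by
    exact Finsupp.range_linearCombination ℤ
  let F₀ : LinearMap.range L₁ →ₗ[ℤ] R :=
    ((LinearMap.ker L₁).liftQ L₂ hker).comp L₁.quotKerEquivRange.symm.toLinearMap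
  refine ⟨F₀.comp (LinearEquiv.ofEq _ _ hrange.symm).toLinearMap, fun γ ↦ ?_⟩
  have e : (LinearEquiv.ofEq _ _ hrange.symm) ⟨periodFunctional N γ, Submodule.subset_span ⟨γ, rfl⟩⟩ =
      ⟨L₁ (Finsupp.single γ 1), LinearMap.mem_range_self _ _⟩ := by
    apply Subtype.ext
    simp [L₁, Finsupp.linearCombination_single]
  rw [LinearMap.comp_apply, LinearEquiv.coe_toLinearMap, e]
  simp only [F₀, LinearMap.comp_apply, LinearEquiv.coe_toLinearMap, LinearMap.quotKerEquivRange_symm_apply_image,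
    Submodule.mkQ_apply, Submodule.liftQ_apply]
  simp [L₂, Finsupp.linearCombination_single]

/-- **The same linear form on the tree's `periodHomology N = H₁(X₀(N), ℤ) ⊆ S₂(Γ₀(N))^∨`** (an `AddSubgroup`, the
closure of the period functionals = the `ℤ`-span as a set): an additive `F : periodHomology N →+ R` with
`F({∞, γ∞}) = Φ(γ·∞)` for every `γ ∈ Γ₀(N)`. [cite: Manin1972, Thm. 1.9] -/
theorem exists_addMonoidHom_periodHomology (hN : Odd N)
    (hM : ∀ (γ : Gamma0 N) (r : ℚ), ((γ : SL(2, ℤ)) 1 0 : ℚ) * r + ((γ : SL(2, ℤ)) 1 1 : ℚ) ≠ 0 →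
      Φ ((((γ : SL(2, ℤ)) 0 0 : ℚ) * r + ((γ : SL(2, ℤ)) 0 1 : ℚ)) /
        (((γ : SL(2, ℤ)) 1 0 : ℚ) * r + ((γ : SL(2, ℤ)) 1 1 : ℚ))) =
        (if ((γ : SL(2, ℤ)) 1 0) = 0 then 0 else Φ ((((γ : SL(2, ℤ)) 0 0 : ℚ)) / (((γ : SL(2, ℤ)) 1 0 : ℚ)))) + Φ r)
    (hT : ∀ x : ℚ, (∑ j : Fin 2, Φ ((x + j) / 2)) + Φ (2 * x) = 0)
    (h3 : ∀ r : R, r + r + r = 0 → r = 0)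
    (hgenus : twelve_mul_finrank_cuspForm_two (Gamma0 N)) :
    ∃ F : periodHomology N →+ R,
      ∀ γ : Gamma0 N, F ⟨periodFunctional N γ, periodFunctional_mem_periodHomology N γ⟩ =
        (if ((γ : SL(2, ℤ)) 1 0) = 0 then 0 else Φ ((((γ : SL(2, ℤ)) 0 0 : ℚ)) / (((γ : SL(2, ℤ)) 1 0 : ℚ)))) := by
  obtain ⟨F, hF⟩ := exists_linearMap_span_periodFunctional hN hM hT h3 hgenus
  have hmem : ∀ x : periodHomology N,
      (x : Module.Dual ℂ (CuspForm (Gamma0 N) 2)) ∈ Submodule.span ℤ (Set.range (periodFunctional N)) := by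
    intro x
    rw [← Submodule.mem_toAddSubgroup, Submodule.span_int_eq_addSubgroupClosure]
    exact x.2
  refine ⟨AddMonoidHom.mk' (fun x ↦ F ⟨x, hmem x⟩) fun a b ↦ ?_, fun γ ↦ hF γ⟩
  rw [← map_add]
  rfl

end Lift

/-! ## §2. Hecke operators on period functionals with explicit translates (B2) -/

section Hecke

variable {N : ℕ} [NeZero N] {p : ℕ} [NeZero p]

/-- **`T_p` on period functionals and on symbol functions through the SAME translates.** For `p` prime and
`γ ∈ Γ₀(N)` there are `δ₀, …, δ_{p−1}, δ' ∈ Γ₀(N)` with `δⱼ·∞ = (γ·∞ + j)/p`, `δ'·∞ = p·(γ·∞)` (the tree's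
`exists_gamma0_inftyImage_tpB/tpD`; `δ·∞ = ∞` iff `γ·∞ = ∞`) such that
(a) `{∞, γ∞}_{T_p h} = Σⱼ {∞, δⱼ∞}_h + 𝟙_{p∤N} {∞, δ'∞}_h` for every `h ∈ S₂(Γ₀(N))` (as `exists_cuspSymbol_heckeT`), and
(b) for EVERY function `Φ : ℚ → R`: `(T_pΦ)^(γ) = Σⱼ Φ̂(δⱼ) + 𝟙_{p∤N} Φ̂(δ')`, where
`(T_pΦ)(x) = Σⱼ Φ((x+j)/p) + 𝟙_{p∤N} Φ(px)` (the `T_q`/`U_ℓ` shape of (C3k)) and `^` is the cusp value at `γ·∞` (`0`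
at `∞`). [cite: CremonaAlgorithms1997, §2.4 (2.4.1)–(2.4.2)] -/
theorem exists_heckeT_translates (hp : p.Prime) (γ : Gamma0 N) :
    ∃ (δ : Fin p → Gamma0 N) (δ' : Gamma0 N),
      (∀ h : CuspForm (Gamma0 N) 2, cuspSymbol (heckeT (Gamma0 N) 2 p h) γ =
        ∑ j : Fin p, cuspSymbol h (δ j) + if p ∣ N then 0 else cuspSymbol h δ') ∧
      ∀ {R : Type} [AddCommGroup R] (Φ : ℚ → R),
        (if ((γ : SL(2, ℤ)) 1 0) = 0 then (0 : R)
          else ((∑ j : Fin p, Φ (((((γ : SL(2, ℤ)) 0 0 : ℚ)) / (((γ : SL(2, ℤ)) 1 0 : ℚ)) + j) / p)) +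
            if p ∣ N then 0 else Φ (p * ((((γ : SL(2, ℤ)) 0 0 : ℚ)) / (((γ : SL(2, ℤ)) 1 0 : ℚ)))))) =
          (∑ j : Fin p, (if (((δ j : Gamma0 N) : SL(2, ℤ)) 1 0) = 0 then 0 else Φ (((((δ j : Gamma0 N) : SL(2, ℤ)) 0 0 : ℚ)) / ((((δ j : Gamma0 N) : SL(2, ℤ)) 1 0 : ℚ))))) +
            if p ∣ N then 0 else (if ((δ' : SL(2, ℤ)) 1 0) = 0 then 0 else Φ ((((δ' : SL(2, ℤ)) 0 0 : ℚ)) / (((δ' : SL(2, ℤ)) 1 0 : ℚ)))) := by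
  choose δ hδ0 hδ using fun j : Fin p ↦ exists_gamma0_inftyImage_tpB hp γ ((j : ℕ) : ℤ)
  -- the cusp-form side, as in the tree's `exists_cuspSymbol_heckeT`
  have key : ∀ h : CuspForm (Gamma0 N) 2, (γ : SL(2, ℤ)) 1 0 ≠ 0 →
      ∑ j : Fin p, modularSymbol h
          ((((γ : SL(2, ℤ)) 0 0 : ℚ) / ((γ : SL(2, ℤ)) 1 0 : ℚ) + ((j : ℕ) : ℤ)) / p) =
        ∑ j : Fin p, cuspSymbol h (δ j) := by
    intro h hc
    refine Finset.sum_congr rfl fun j _ ↦ ?_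
    rw [cuspSymbol, if_neg (fun h0 ↦ hc ((hδ0 j).mp h0)), hδ j hc]
  -- the symbol-function side
  have keyΦ : ∀ {R : Type} [AddCommGroup R] (Φ : ℚ → R), (γ : SL(2, ℤ)) 1 0 ≠ 0 →
      ∑ j : Fin p, Φ (((((γ : SL(2, ℤ)) 0 0 : ℚ)) / (((γ : SL(2, ℤ)) 1 0 : ℚ)) + j) / p) =
        ∑ j : Fin p, (if (((δ j : Gamma0 N) : SL(2, ℤ)) 1 0) = 0 then 0 else Φ (((((δ j : Gamma0 N) : SL(2, ℤ)) 0 0 : ℚ)) / ((((δ j : Gamma0 N) : SL(2, ℤ)) 1 0 : ℚ)))) := by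
    intro R _ Φ hc
    refine Finset.sum_congr rfl fun j _ ↦ ?_
    rw [if_neg (fun h0 ↦ hc ((hδ0 j).mp h0)), hδ j hc]
    push_cast
    rfl
  by_cases hpN : p ∣ N
  · refine ⟨δ, 1, fun h ↦ ?_, fun Φ ↦ ?_⟩
    · rw [if_pos hpN, add_zero]
      by_cases hc : (γ : SL(2, ℤ)) 1 0 = 0
      · rw [cuspSymbol, if_pos hc]
        symm
        exact Finset.sum_eq_zero fun j _ ↦ by rw [cuspSymbol, if_pos ((hδ0 j).mpr hc)]
      · rw [cuspSymbol, if_neg hc, modularSymbol_heckeT_eq_sum p h hp, if_pos hpN, add_zero]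
        exact key h hc
    · simp only [if_pos hpN, add_zero]
      by_cases hc : (γ : SL(2, ℤ)) 1 0 = 0
      · rw [if_pos hc]
        symm
        exact Finset.sum_eq_zero fun j _ ↦ by rw [if_pos ((hδ0 j).mpr hc)]
      · rw [if_neg hc]
        exact keyΦ Φ hc
  · obtain ⟨δ', hδ'0, hδ'⟩ := exists_gamma0_inftyImage_tpD hp hpN γ
    refine ⟨δ, δ', fun h ↦ ?_, fun Φ ↦ ?_⟩
    · rw [if_neg hpN]
      by_cases hc : (γ : SL(2, ℤ)) 1 0 = 0
      · rw [cuspSymbol, if_pos hc, cuspSymbol, if_pos (hδ'0.mpr hc), add_zero]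
        symm
        exact Finset.sum_eq_zero fun j _ ↦ by rw [cuspSymbol, if_pos ((hδ0 j).mpr hc)]
      · rw [cuspSymbol, if_neg hc, modularSymbol_heckeT_eq_sum p h hp, if_neg hpN,
          cuspSymbol, if_neg (fun h0 ↦ hc (hδ'0.mp h0)), hδ' hc, key h hc]
    · rw [if_neg hpN, if_neg hpN]
      by_cases hc : (γ : SL(2, ℤ)) 1 0 = 0
      · rw [if_pos hc, if_pos (hδ'0.mpr hc), add_zero]
        symm
        exact Finset.sum_eq_zero fun j _ ↦ by rw [if_pos ((hδ0 j).mpr hc)]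
      · rw [if_neg hc, if_neg (fun h0 ↦ hc (hδ'0.mp h0)), hδ' hc, keyΦ Φ hc]

/-- The same translates act on the period FUNCTIONALS: `T_p^∨ {∞, γ∞} = Σⱼ {∞, δⱼ∞} + 𝟙_{p∤N} {∞, δ'∞}` in
`S₂(Γ₀(N))^∨`. [cite: CremonaAlgorithms1997, §2.4 (2.4.2)] -/
theorem dualMap_heckeT_periodFunctional_eq_of_translates {δ : Fin p → Gamma0 N} {δ' : Gamma0 N} {γ : Gamma0 N}
    (H : ∀ h : CuspForm (Gamma0 N) 2, cuspSymbol (heckeT (Gamma0 N) 2 p h) γ =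
        ∑ j : Fin p, cuspSymbol h (δ j) + if p ∣ N then 0 else cuspSymbol h δ') :
    (heckeT (Gamma0 N) 2 p).dualMap (periodFunctional N γ) =
      ∑ j : Fin p, periodFunctional N (δ j) + if p ∣ N then 0 else periodFunctional N δ' := by
  ext h
  rw [LinearMap.dualMap_apply, periodFunctional_apply, H h]
  split_ifs <;> simp

omit [NeZero N] [NeZero p] in
/-- **Eigen-symbols give eigen-forms on `H₁` (B2).** If `Φ` is an exact `T_p`-eigenfunction in the shape of (C3k)
(`Σⱼ Φ((x+j)/p) + 𝟙_{p∤N}Φ(px) = a·Φ(x)` for all `x`; `R` a module over a commutative ring `K`, `a ∈ K`), then with the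
translates of `exists_heckeT_translates`: `Σⱼ Φ̂(δⱼ) + 𝟙_{p∤N} Φ̂(δ') = a·Φ̂(γ)`. Combined with §1's linear form `F`
(`F{∞,γ∞} = Φ̂(γ)`) and `dualMap_heckeT_periodFunctional_eq_of_translates`: `F(T_p^∨ {∞, γ∞}) = a·F({∞, γ∞})`.
[cite: CremonaAlgorithms1997, §2.4] -/
theorem sum_translates_eq_smul_of_eigen {K R : Type} [CommRing K] [AddCommGroup R] [Module K R] (Φ : ℚ → R) (a : K)
    (heig : ∀ x : ℚ, (∑ j : Fin p, Φ ((x + j) / p)) + (if p ∣ N then 0 else Φ (p * x)) = a • Φ x)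
    {γ : Gamma0 N} {δ : Fin p → Gamma0 N} {δ' : Gamma0 N}
    (HΦ : (if ((γ : SL(2, ℤ)) 1 0) = 0 then (0 : R)
          else ((∑ j : Fin p, Φ (((((γ : SL(2, ℤ)) 0 0 : ℚ)) / (((γ : SL(2, ℤ)) 1 0 : ℚ)) + j) / p)) +
            if p ∣ N then 0 else Φ (p * ((((γ : SL(2, ℤ)) 0 0 : ℚ)) / (((γ : SL(2, ℤ)) 1 0 : ℚ)))))) =
          (∑ j : Fin p, (if (((δ j : Gamma0 N) : SL(2, ℤ)) 1 0) = 0 then 0 else Φ (((((δ j : Gamma0 N) : SL(2, ℤ)) 0 0 : ℚ)) / ((((δ j : Gamma0 N) : SL(2, ℤ)) 1 0 : ℚ))))) +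
            if p ∣ N then 0 else (if ((δ' : SL(2, ℤ)) 1 0) = 0 then 0 else Φ ((((δ' : SL(2, ℤ)) 0 0 : ℚ)) / (((δ' : SL(2, ℤ)) 1 0 : ℚ))))) :
    (∑ j : Fin p, (if (((δ j : Gamma0 N) : SL(2, ℤ)) 1 0) = 0 then 0 else Φ (((((δ j : Gamma0 N) : SL(2, ℤ)) 0 0 : ℚ)) / ((((δ j : Gamma0 N) : SL(2, ℤ)) 1 0 : ℚ))))) +
        (if p ∣ N then 0 else (if ((δ' : SL(2, ℤ)) 1 0) = 0 then 0 else Φ ((((δ' : SL(2, ℤ)) 0 0 : ℚ)) / (((δ' : SL(2, ℤ)) 1 0 : ℚ))))) =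
      a • (if ((γ : SL(2, ℤ)) 1 0) = 0 then 0 else Φ ((((γ : SL(2, ℤ)) 0 0 : ℚ)) / (((γ : SL(2, ℤ)) 1 0 : ℚ)))) := by
  rw [← HΦ]
  by_cases hc : (γ : SL(2, ℤ)) 1 0 = 0
  · rw [if_pos hc, if_pos hc, smul_zero]
  · rw [if_neg hc, if_neg hc, heig]

end Hecke

end Summit.BirchSwinnertonDyer.BirchSwinnertonDyer.Theorems.ThetaLayerLambdaCongruenceAtTwo

end
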